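import Literature.NumberTheory.LFunctions.SoundArchTerm
import HarnessLib

/-!
# `Re W_∞(g_z) = L log t + O(L)` for the test function `g_z = e^{−(z−½)|y|}(log x − |y|)₊`

Topic `Literature/NumberTheory/LFunctions`. Everything in this file is PROVED. Continuation of
`SoundArchTerm.lean`: the evaluation of the archimedean term of the Guinand–Weil explicit formula
for `g = SoundTest.test c L`, `c = (u − ½) + it`, which replaces the terms `−ζ'/ζ(z) log x`,
`−(ζ'/ζ)'(z)` of M. Balazard, A. de Roton, arXiv:0810.3587, Prop. 3/(t55) in the Weil-formula
derivation of their Prop. 5 (Soundararajan's main lemma).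

* `SoundTest.integral_weilMellin_test_half` — the mass `∫ ĝ(½ + iτ) dτ = 2π g(0) = 2πL`
  (Fourier inversion at `0`).
* `SoundTest.integral_absF_le` — `∫ |Re ĝ(½+iτ)| · |Re ψ(¼+iτ/2) − log(t/2)| dτ ≤ K L`
  (regions `|τ − t| ≤ t/2` with the quarter-line Stirling bound, `|τ| ≤ t/2` and `|τ| ≥ 3t/2`
  with the real part of the `L`-term `Re(2Lc/(a₁a₂)) = 2Lc'(c'²+τ²+t²)/|a₁a₂|²`, evenness in `τ`).
* `SoundTest.re_weilArchTerm_test` — **`|Re W_∞(g) − L log t| ≤ K L`** for `0 ≤ c' ≤ 3/2`,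
  `t ≥ 8`, `1 ≤ L ≤ t`.

## References

* [BalazardDeRoton2008] M. Balazard, A. de Roton, arXiv:0810.3587, Props. 3–5. [cite: BalazardDeRoton2008, Prop. 5 (proof)]
-/

noncomputable section

open Complex Filter Set MeasureTheory Topology intervalIntegral
open scoped Real FourierTransform

namespace Literature.NumberTheory.LFunctions

namespace SoundTest

open Literature.Analysis.SpecialFunctions

/-! ## The mass `∫ ĝ(½ + iτ) dτ = 2πL` -/

/-- `g(0) = L` (`L ≥ 0`). [folklore] -/
theorem test_zero (c : ℂ) {L : ℝ} (hL : 0 ≤ L) : test c L 0 = (L : ℂ) := by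
  simp [test, max_eq_left hL]

/-- The Fourier transform of `g` is `ĝ` on the critical line: `𝓕 g(ξ) = ĝ(½ − 2πξ i)`. [folklore] -/
theorem fourier_test_eq (c : ℂ) (L ξ : ℝ) :
    𝓕 (test c L) ξ = weilMellin (test c L) (1 / 2 + ((-(2 * π * ξ) : ℝ) : ℂ) * I) := by
  rw [weilMellin_half_line_eq, Real.fourier_real_eq_integral_exp_smul]
  refine integral_congr_ae (Eventually.of_forall fun v ↦ ?_)
  simp only [smul_eq_mul]
  rw [mul_comm]
  congr 1
  push_cast
  ring_nf

/-- **The mass of `ĝ` on the critical line**: `∫ ĝ(½ + iτ) dτ = 2π L` (Fourier inversion at `0`;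
`Re c ≥ 0`, `L ≥ 0`). [folklore] -/
theorem integral_weilMellin_test_half {c : ℂ} (hc : 0 ≤ c.re) {L : ℝ} (hL : 0 ≤ L) :
    ∫ τ : ℝ, weilMellin (test c L) (1 / 2 + τ * I) = 2 * π * L := by
  set h : ℝ → ℂ := fun τ ↦ weilMellin (test c L) (1 / 2 + τ * I) with hh
  have hhi : Integrable h := integrable_weilMellin_test_half hc hL
  have hgc := continuous_test c L
  have hgi : Integrable (test c L) := hgc.integrable_of_hasCompactSupport (hasCompactSupport_test c L)
  -- `𝓕 g = h ∘ (−2π ·)`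
  have hF : 𝓕 (test c L) = fun ξ : ℝ ↦ h (-(2 * π) * ξ) := by
    funext ξ
    rw [fourier_test_eq, hh]
    congr 2; push_cast; ring
  have hFi : Integrable (𝓕 (test c L)) := by
    rw [hF]
    exact hhi.comp_mul_left' (neg_ne_zero.2 (by positivity : (2 * π : ℝ) ≠ 0))
  -- inversion at `0`: `g(0) = ∫ 𝓕 g`
  have hinv0 : test c L 0 = ∫ v : ℝ, 𝓕 (test c L) v := by
    rw [← congrFun (hgc.fourierInv_fourier_eq hgi hFi) 0, Real.fourierInv_eq']
    refine integral_congr_ae (Eventually.of_forall fun v ↦ ?_)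
    simp
  rw [test_zero c hL, hF, Measure.integral_comp_mul_left (fun τ : ℝ ↦ h τ) (-(2 * π)),
    abs_inv, abs_neg, abs_of_pos (by positivity : (0 : ℝ) < 2 * π), real_smul] at hinv0
  -- `(2π)⁻¹ • ∫ h = L`
  have : ∫ τ : ℝ, h τ = ((2 * π : ℝ) : ℂ) * (L : ℂ) := by
    rw [hinv0, ← mul_assoc]
    push_cast
    field_simp
  rw [this]; push_cast; ring

/-! ## Pointwise bounds in the three regions

Throughout `c = c' + it` with `0 ≤ c' ≤ 3/2`, `t ≥ 8`; `a₁ = iτ − c = −c' + i(τ − t)`,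
`a₂ = −iτ − c = −c' − i(τ + t)`. -/

section Regions

variable {c' t L : ℝ}

/-- The two shifted points. [folklore] -/
theorem a_eqs (c' t τ : ℝ) :
    (τ : ℂ) * I - ((c' : ℂ) + t * I) = -(c' : ℂ) + ((τ - t : ℝ) : ℂ) * I ∧
      -((τ : ℂ) * I) - ((c' : ℂ) + t * I) = -(c' : ℂ) - ((τ + t : ℝ) : ℂ) * I := by
  constructor <;> (push_cast; ring)

/-- `‖−c' + iω‖ ≥ |ω|` and its real part is `−c' ≤ 0`. [folklore] -/
theorem norm_shift_ge (c' ω : ℝ) : |ω| ≤ ‖-(c' : ℂ) + (ω : ℂ) * I‖ := by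
  have := Complex.abs_im_le_norm (-(c' : ℂ) + (ω : ℂ) * I)
  simpa using this

/-- `‖Ψ(a₂)‖ ≤ 2/t² + L/t` for `τ ≥ 0` (`|a₂| ≥ τ + t ≥ t`). [folklore] -/
theorem norm_psiInt_a2_le (hc0 : 0 ≤ c') (ht : 0 < t) (hL : 0 ≤ L) {τ : ℝ} (hτ : 0 ≤ τ) :
    ‖psiInt L (-((τ : ℂ) * I) - ((c' : ℂ) + t * I))‖ ≤ 2 / t ^ 2 + L / t := by
  rw [(a_eqs c' t τ).2]
  set a : ℂ := -(c' : ℂ) - ((τ + t : ℝ) : ℂ) * I with ha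
  have him : a.im = -(τ + t) := by simp [ha]
  have hna : t ≤ ‖a‖ := by
    have := Complex.abs_im_le_norm a
    rw [him, abs_neg, abs_of_nonneg (by linarith)] at this
    linarith
  have ha0 : a ≠ 0 := fun h ↦ by rw [h, norm_zero] at hna; linarith
  have hare : a.re ≤ 0 := by simp [ha]; exact hc0
  refine (norm_psiInt_le_inv hL ha0 hare).trans ?_
  rw [add_div]
  have h1 : 2 / ‖a‖ ^ 2 ≤ 2 / t ^ 2 := by gcongr
  have h2 : ‖a‖ * L / ‖a‖ ^ 2 = L / ‖a‖ := by
    have : ‖a‖ ≠ 0 := by linarith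
    field_simp
  have h3 : L / ‖a‖ ≤ L / t := div_le_div_of_nonneg_left hL ht hna
  rw [h2]; linarith

/-- `‖Ψ(a₁)‖ ≤ 2/(τ−t)² + L/|τ−t|` for `τ ≠ t` (`|a₁| ≥ |τ − t|`). [folklore] -/
theorem norm_psiInt_a1_le (hc0 : 0 ≤ c') (hL : 0 ≤ L) {τ : ℝ} (hτ : τ ≠ t) :
    ‖psiInt L ((τ : ℂ) * I - ((c' : ℂ) + t * I))‖ ≤ 2 / (τ - t) ^ 2 + L / |τ - t| := by
  rw [(a_eqs c' t τ).1]
  set a : ℂ := -(c' : ℂ) + ((τ - t : ℝ) : ℂ) * I with ha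
  have hω : 0 < |τ - t| := abs_pos.2 (sub_ne_zero.2 hτ)
  have hna : |τ - t| ≤ ‖a‖ := norm_shift_ge c' (τ - t)
  have ha0 : a ≠ 0 := fun h ↦ by rw [h, norm_zero] at hna; linarith
  have hare : a.re ≤ 0 := by simp [ha]; exact hc0
  refine (norm_psiInt_le_inv hL ha0 hare).trans ?_
  rw [add_div]
  have h1 : 2 / ‖a‖ ^ 2 ≤ 2 / (τ - t) ^ 2 := by
    rw [← sq_abs (τ - t)]; gcongr
  have h2 : ‖a‖ * L / ‖a‖ ^ 2 = L / ‖a‖ := by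
    have : ‖a‖ ≠ 0 := by linarith
    field_simp
  have h3 : L / ‖a‖ ≤ L / |τ - t| := div_le_div_of_nonneg_left hL hω hna
  rw [h2]; linarith

/-- The weight in region A: for `t/2 ≤ τ ≤ 3t/2`, `t ≥ 8`,
`|Re ψ(¼+iτ/2) − log(t/2)| ≤ 10/t + 2|τ − t|/t`. [folklore] -/
theorem abs_weight_regionA (ht : 8 ≤ t) {τ : ℝ} (hτ1 : t / 2 ≤ τ) (hτ2 : τ ≤ 3 * t / 2) :
    |reDigammaQuarter τ - Real.log (t / 2)| ≤ 10 / t + 2 * |τ - t| / t := by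
  have ht0 : 0 < t := by linarith
  have hτ1' : 1 ≤ τ := by linarith
  have h1 := abs_reDigammaQuarter_sub_log_le hτ1'
  have h2 : 5 / τ ≤ 10 / t := by
    rw [div_le_div_iff₀ (by linarith) ht0]; linarith
  -- `log(τ/2) − log(t/2) = log(1 + (τ−t)/t)`
  have h3 : Real.log (τ / 2) - Real.log (t / 2) = Real.log (1 + (τ - t) / t) := by
    rw [← Real.log_div (by positivity) (by positivity)]
    congr 1; field_simp; ring
  have h4 : |(τ - t) / t| ≤ 1 / 2 := by
    rw [abs_div, abs_of_pos ht0, div_le_div_iff₀ ht0 (by norm_num)]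
    have : |τ - t| ≤ t / 2 := abs_le.2 ⟨by linarith, by linarith⟩
    linarith
  -- `|log(1 + y)| ≤ 2|y|` for `|y| ≤ 1/2` (cf. `BombieriSieve.abs_log_one_add_le`)
  have hlog1 : ∀ {y : ℝ}, |y| ≤ 1 / 2 → |Real.log (1 + y)| ≤ 2 * |y| := by
    intro y hy
    obtain ⟨hy1, hy2⟩ := abs_le.1 hy
    have hpos : 0 < 1 + y := by linarith
    have hup : Real.log (1 + y) ≤ y := by
      have := Real.log_le_sub_one_of_pos hpos; linarith
    have hdown : -(2 * |y|) ≤ Real.log (1 + y) := by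
      have h := Real.one_sub_inv_le_log_of_pos hpos
      have : -(2 * |y|) ≤ 1 - (1 + y)⁻¹ := by
        rw [show 1 - (1 + y)⁻¹ = y / (1 + y) by field_simp; ring, le_div_iff₀ hpos]
        cases' abs_cases y with h h <;> nlinarith
      linarith
    rw [abs_le]; constructor <;> cases' abs_cases y with h h <;> linarith
  have h5 := hlog1 h4
  rw [abs_div, abs_of_pos ht0] at h5
  calc |reDigammaQuarter τ - Real.log (t / 2)|
      = |(reDigammaQuarter τ - Real.log (τ / 2)) + (Real.log (τ / 2) - Real.log (t / 2))| := by ring_nf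
    _ ≤ |reDigammaQuarter τ - Real.log (τ / 2)| + |Real.log (τ / 2) - Real.log (t / 2)| := abs_add_le _ _
    _ ≤ 10 / t + 2 * |τ - t| / t := by
        rw [h3]
        have : 2 * (|τ - t| / t) = 2 * |τ - t| / t := by ring
        linarith

/-- The product `a₁ a₂ = (c'² + τ² − t²) + 2ic't` and the real part of the `L`-term:
`Re(2Lc/(a₁a₂)) = 2L c'(c'² + τ² + t²)/|a₁a₂|²`. [folklore] -/
theorem re_lterm_eq (c' t L τ : ℝ) (h : ((τ : ℂ) * I - ((c' : ℂ) + t * I)) * (-((τ : ℂ) * I) - ((c' : ℂ) + t * I)) ≠ 0) :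
    ((2 * (L : ℂ) * ((c' : ℂ) + t * I)) /
        (((τ : ℂ) * I - ((c' : ℂ) + t * I)) * (-((τ : ℂ) * I) - ((c' : ℂ) + t * I)))).re =
      2 * L * (c' * (c' ^ 2 + τ ^ 2 + t ^ 2)) /
        ((c' ^ 2 + τ ^ 2 - t ^ 2) ^ 2 + (2 * c' * t) ^ 2) := by
  set P : ℂ := ((τ : ℂ) * I - ((c' : ℂ) + t * I)) * (-((τ : ℂ) * I) - ((c' : ℂ) + t * I)) with hP
  have hPre : P.re = c' ^ 2 + τ ^ 2 - t ^ 2 := by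
    simp [hP]; ring
  have hPim : P.im = 2 * c' * t := by
    simp [hP]; ring
  have hnorm : Complex.normSq P = (c' ^ 2 + τ ^ 2 - t ^ 2) ^ 2 + (2 * c' * t) ^ 2 := by
    rw [Complex.normSq_apply, hPre, hPim]; ring
  have hnorm0 : Complex.normSq P ≠ 0 := by rwa [Ne, Complex.normSq_eq_zero]
  rw [Complex.div_re, hnorm]
  simp only [Complex.mul_re, Complex.mul_im, Complex.add_re, Complex.add_im, Complex.ofReal_re,
    Complex.ofReal_im, Complex.I_re, Complex.I_im, mul_zero, mul_one, zero_add, add_zero, sub_zero,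
    Complex.re_ofNat, Complex.im_ofNat, zero_mul, hPre, hPim]
  rw [← hnorm]
  field_simp
  ring

/-- `ĝ(½ + iτ)` is even in `τ`. [folklore] -/
theorem weilMellin_test_half_neg (c : ℂ) {L : ℝ} (hL : 0 ≤ L) (τ : ℝ) :
    weilMellin (test c L) (1 / 2 + ((-τ : ℝ) : ℂ) * I) = weilMellin (test c L) (1 / 2 + τ * I) := by
  rw [weilMellin_test_half c hL, weilMellin_test_half c hL, add_comm]
  congr 2 <;> push_cast <;> ring

/-- The exponential pieces are small: `‖e^{a₁L}/a₁² + e^{a₂L}/a₂²‖, ‖1/a₁² + 1/a₂²‖ ≤ 1/‖a₁‖² + 1/‖a₂‖²`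
(`Re aᵢ ≤ 0`). [folklore] -/
theorem norm_pieces_le {a b : ℂ} (ha : a.re ≤ 0) (hb : b.re ≤ 0) (hL : 0 ≤ L) :
    ‖Complex.exp (a * L) / a ^ 2 + Complex.exp (b * L) / b ^ 2‖ ≤ 1 / ‖a‖ ^ 2 + 1 / ‖b‖ ^ 2 ∧
      ‖(1 / a ^ 2 + 1 / b ^ 2 : ℂ)‖ ≤ 1 / ‖a‖ ^ 2 + 1 / ‖b‖ ^ 2 := by
  have hexp : ∀ {z : ℂ}, z.re ≤ 0 → ‖Complex.exp (z * L)‖ ≤ 1 := fun {z} hz ↦ by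
    rw [Complex.norm_exp]
    refine Real.exp_le_one_iff.2 ?_
    have : (z * (L : ℂ)).re = z.re * L := by simp
    rw [this]; exact mul_nonpos_of_nonpos_of_nonneg hz hL
  constructor
  · calc ‖Complex.exp (a * L) / a ^ 2 + Complex.exp (b * L) / b ^ 2‖
        ≤ ‖Complex.exp (a * L)‖ / ‖a‖ ^ 2 + ‖Complex.exp (b * L)‖ / ‖b‖ ^ 2 := by
          refine (norm_add_le _ _).trans ?_; rw [norm_div, norm_div, norm_pow, norm_pow]
      _ ≤ 1 / ‖a‖ ^ 2 + 1 / ‖b‖ ^ 2 := by gcongr <;> exact hexp ‹_›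
  · refine (norm_add_le _ _).trans ?_
    rw [norm_div, norm_div, norm_one, norm_pow, norm_pow]

/-- The skeleton bound for `|Re ĝ(½+iτ)|` in region C: with `m₁ ≤ ‖a₁‖`, `m₂ ≤ ‖a₂‖` and a bound
`B` for the real part of the `L`-term, `|Re ĝ| ≤ 2(1/m₁² + 1/m₂²) + B`. [folklore] -/
theorem abs_re_weilMellin_test_half_le_skeleton (hc0 : 0 ≤ c') (hL : 0 ≤ L) {τ m₁ m₂ B : ℝ}
    (hm₁ : 0 < m₁) (hm₂ : 0 < m₂)
    (h₁ : m₁ ≤ ‖(τ : ℂ) * I - ((c' : ℂ) + t * I)‖) (h₂ : m₂ ≤ ‖-((τ : ℂ) * I) - ((c' : ℂ) + t * I)‖)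
    (hB : 2 * L * (c' * (c' ^ 2 + τ ^ 2 + t ^ 2)) / ((c' ^ 2 + τ ^ 2 - t ^ 2) ^ 2 + (2 * c' * t) ^ 2) ≤ B) :
    |(weilMellin (test ((c' : ℂ) + t * I) L) (1 / 2 + τ * I)).re| ≤ 2 * (1 / m₁ ^ 2 + 1 / m₂ ^ 2) + B := by
  set c : ℂ := (c' : ℂ) + t * I with hc
  set a₁ : ℂ := (τ : ℂ) * I - c with ha₁
  set a₂ : ℂ := -((τ : ℂ) * I) - c with ha₂
  have h10 : a₁ ≠ 0 := fun h ↦ by rw [h, norm_zero] at h₁; linarith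
  have h20 : a₂ ≠ 0 := fun h ↦ by rw [h, norm_zero] at h₂; linarith
  have h1re : a₁.re ≤ 0 := by simp [ha₁, hc]; exact hc0
  have h2re : a₂.re ≤ 0 := by simp [ha₂, hc]; exact hc0
  rw [weilMellin_test_half c hL, psiInt_add_psiInt h10 h20]
  have hsum : a₁ + a₂ = -2 * c := by rw [ha₁, ha₂]; ring
  obtain ⟨hE₁, hE₂⟩ := norm_pieces_le (a := a₁) (b := a₂) h1re h2re hL
  -- the `L`-term and its real part
  have hP : a₁ * a₂ ≠ 0 := mul_ne_zero h10 h20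
  have hLterm : (L : ℂ) * (a₁ + a₂) / (a₁ * a₂) = -(2 * (L : ℂ) * c / (a₁ * a₂)) := by
    rw [hsum]; ring
  have hre := re_lterm_eq c' t L τ (by rw [← ha₁, ← ha₂] at *; exact hP)
  -- assemble
  have hinv1 : 1 / ‖a₁‖ ^ 2 ≤ 1 / m₁ ^ 2 := by gcongr
  have hinv2 : 1 / ‖a₂‖ ^ 2 ≤ 1 / m₂ ^ 2 := by gcongr
  have hnn : 0 ≤ 2 * L * (c' * (c' ^ 2 + τ ^ 2 + t ^ 2)) / ((c' ^ 2 + τ ^ 2 - t ^ 2) ^ 2 + (2 * c' * t) ^ 2) := by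
    positivity
  rw [hLterm, sub_neg_eq_add, Complex.add_re, Complex.sub_re]
  have e3 : (2 * (L : ℂ) * c / (a₁ * a₂)).re =
      2 * L * (c' * (c' ^ 2 + τ ^ 2 + t ^ 2)) / ((c' ^ 2 + τ ^ 2 - t ^ 2) ^ 2 + (2 * c' * t) ^ 2) := by
    rw [← hre]
  rw [e3]
  have hb1 := (Complex.abs_re_le_norm _).trans hE₁
  have hb2 := (Complex.abs_re_le_norm _).trans hE₂
  rw [abs_le] at hb1 hb2 ⊢
  constructor <;> linarith [hb1.1, hb1.2, hb2.1, hb2.2]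

/-- **Region C₁** (`0 ≤ τ ≤ t/2`): `|Re ĝ(½+iτ)| ≤ (10 + 18L)/t²` (`0 ≤ c' ≤ 3/2`, `t ≥ 8`). [folklore] -/
theorem abs_re_weilMellin_test_half_le_C1 (hc0 : 0 ≤ c') (hc1 : c' ≤ 3 / 2) (ht : 8 ≤ t) (hL : 0 ≤ L)
    {τ : ℝ} (hτ0 : 0 ≤ τ) (hτ : τ ≤ t / 2) :
    |(weilMellin (test ((c' : ℂ) + t * I) L) (1 / 2 + τ * I)).re| ≤ (10 + 18 * L) / t ^ 2 := by
  have ht0 : 0 < t := by linarith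
  have h₁ : t / 2 ≤ ‖(τ : ℂ) * I - ((c' : ℂ) + t * I)‖ := by
    rw [(a_eqs c' t τ).1]
    refine le_trans ?_ (norm_shift_ge c' (τ - t))
    rw [abs_of_nonpos (by linarith)]; linarith
  have h₂ : t ≤ ‖-((τ : ℂ) * I) - ((c' : ℂ) + t * I)‖ := by
    rw [(a_eqs c' t τ).2]
    have := Complex.abs_im_le_norm (-(c' : ℂ) - ((τ + t : ℝ) : ℂ) * I)
    simp only [Complex.sub_im, Complex.neg_im, Complex.ofReal_im, neg_zero, Complex.mul_im,
      Complex.ofReal_re, Complex.I_im, mul_one, Complex.I_re, mul_zero, add_zero, zero_sub, abs_neg] at this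
    rw [abs_of_nonneg (by linarith)] at this
    linarith
  have hB : 2 * L * (c' * (c' ^ 2 + τ ^ 2 + t ^ 2)) / ((c' ^ 2 + τ ^ 2 - t ^ 2) ^ 2 + (2 * c' * t) ^ 2) ≤
      18 * L / t ^ 2 := by
    -- numerator ≤ 2L · (3/2) · (3/2) t² = (9/2) L t², denominator ≥ (t²/2)² = t⁴/4
    have hX : t ^ 2 / 2 ≤ -(c' ^ 2 + τ ^ 2 - t ^ 2) := by nlinarith
    have hden : t ^ 4 / 4 ≤ (c' ^ 2 + τ ^ 2 - t ^ 2) ^ 2 + (2 * c' * t) ^ 2 := by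
      have h1 : (t ^ 2 / 2) ^ 2 ≤ (c' ^ 2 + τ ^ 2 - t ^ 2) ^ 2 := by
        have := pow_le_pow_left₀ (by positivity) hX 2
        rwa [neg_sq] at this
      nlinarith [sq_nonneg (2 * c' * t)]
    have hnum : c' * (c' ^ 2 + τ ^ 2 + t ^ 2) ≤ (9 / 4) * t ^ 2 := by
      have : c' ^ 2 + τ ^ 2 + t ^ 2 ≤ (3 / 2) * t ^ 2 := by nlinarith
      calc c' * (c' ^ 2 + τ ^ 2 + t ^ 2) ≤ (3 / 2) * ((3 / 2) * t ^ 2) := by gcongr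
        _ = (9 / 4) * t ^ 2 := by ring
    rw [div_le_div_iff₀ (lt_of_lt_of_le (by positivity) hden) (by positivity)]
    have := mul_le_mul_of_nonneg_left hden (by positivity : 0 ≤ 18 * L)
    have := mul_le_mul_of_nonneg_left hnum (by positivity : 0 ≤ 2 * L * t ^ 2)
    nlinarith
  have := abs_re_weilMellin_test_half_le_skeleton (c' := c') (t := t) hc0 hL (by positivity) ht0 h₁ h₂ hB
  refine this.trans (le_of_eq ?_)
  field_simp
  ring

/-- **Region C₂** (`τ ≥ 3t/2`): `|Re ĝ(½+iτ)| ≤ (20 + 18L)/τ²` (`0 ≤ c' ≤ 3/2`, `t ≥ 8`). [folklore] -/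
theorem abs_re_weilMellin_test_half_le_C2 (hc0 : 0 ≤ c') (hc1 : c' ≤ 3 / 2) (ht : 8 ≤ t) (hL : 0 ≤ L)
    {τ : ℝ} (hτ : 3 * t / 2 ≤ τ) :
    |(weilMellin (test ((c' : ℂ) + t * I) L) (1 / 2 + τ * I)).re| ≤ (20 + 18 * L) / τ ^ 2 := by
  have ht0 : 0 < t := by linarith
  have hτ0 : 0 < τ := by linarith
  have h₁ : τ / 3 ≤ ‖(τ : ℂ) * I - ((c' : ℂ) + t * I)‖ := by
    rw [(a_eqs c' t τ).1]
    refine le_trans ?_ (norm_shift_ge c' (τ - t))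
    rw [abs_of_nonneg (by linarith)]; linarith
  have h₂ : τ ≤ ‖-((τ : ℂ) * I) - ((c' : ℂ) + t * I)‖ := by
    rw [(a_eqs c' t τ).2]
    have := Complex.abs_im_le_norm (-(c' : ℂ) - ((τ + t : ℝ) : ℂ) * I)
    simp only [Complex.sub_im, Complex.neg_im, Complex.ofReal_im, neg_zero, Complex.mul_im,
      Complex.ofReal_re, Complex.I_im, mul_one, Complex.I_re, mul_zero, add_zero, zero_sub, abs_neg] at this
    rw [abs_of_nonneg (by linarith)] at this
    linarith
  have hB : 2 * L * (c' * (c' ^ 2 + τ ^ 2 + t ^ 2)) / ((c' ^ 2 + τ ^ 2 - t ^ 2) ^ 2 + (2 * c' * t) ^ 2) ≤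
      18 * L / τ ^ 2 := by
    have ht2 : t ^ 2 ≤ 4 / 9 * τ ^ 2 := by nlinarith
    have hX : τ ^ 2 / 2 ≤ c' ^ 2 + τ ^ 2 - t ^ 2 := by nlinarith [sq_nonneg c']
    have hden : τ ^ 4 / 4 ≤ (c' ^ 2 + τ ^ 2 - t ^ 2) ^ 2 + (2 * c' * t) ^ 2 := by
      have h1 : (τ ^ 2 / 2) ^ 2 ≤ (c' ^ 2 + τ ^ 2 - t ^ 2) ^ 2 := pow_le_pow_left₀ (by positivity) hX 2
      nlinarith [sq_nonneg (2 * c' * t)]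
    have hnum : c' * (c' ^ 2 + τ ^ 2 + t ^ 2) ≤ (9 / 4) * τ ^ 2 := by
      have hτ12 : (12 : ℝ) ≤ τ := by linarith
      have : c' ^ 2 + τ ^ 2 + t ^ 2 ≤ (3 / 2) * τ ^ 2 := by nlinarith
      calc c' * (c' ^ 2 + τ ^ 2 + t ^ 2) ≤ (3 / 2) * ((3 / 2) * τ ^ 2) := by gcongr
        _ = (9 / 4) * τ ^ 2 := by ring
    rw [div_le_div_iff₀ (lt_of_lt_of_le (by positivity) hden) (by positivity)]
    have := mul_le_mul_of_nonneg_left hden (by positivity : 0 ≤ 18 * L)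
    have := mul_le_mul_of_nonneg_left hnum (by positivity : 0 ≤ 2 * L * τ ^ 2)
    nlinarith
  have := abs_re_weilMellin_test_half_le_skeleton (c' := c') (t := t) hc0 hL (by positivity) hτ0 h₁ h₂ hB
  refine this.trans (le_of_eq ?_)
  field_simp
  ring

/-- **Region A** (`t/2 ≤ τ ≤ 3t/2`, `τ ≠ t`): `‖ĝ(½+iτ)‖ ≤ (2/(τ−t)² + L/|τ−t|) + (2/t² + L/t)`. [folklore] -/
theorem norm_weilMellin_test_half_le_A (hc0 : 0 ≤ c') (ht : 0 < t) (hL : 0 ≤ L) {τ : ℝ} (hτ0 : 0 ≤ τ)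
    (hτ : τ ≠ t) :
    ‖weilMellin (test ((c' : ℂ) + t * I) L) (1 / 2 + τ * I)‖ ≤
      (2 / (τ - t) ^ 2 + L / |τ - t|) + (2 / t ^ 2 + L / t) := by
  rw [weilMellin_test_half _ hL]
  exact (norm_add_le _ _).trans (add_le_add (norm_psiInt_a1_le hc0 hL hτ) (norm_psiInt_a2_le hc0 ht hL hτ0))

/-! ## Pointwise bounds for `|Re ĝ(½+iτ)| · |R(τ) − log(t/2)|` -/

/-- The weight is crude-bounded everywhere: `|R(τ) − log(t/2)| ≤ C + log(1+|τ|) + log t` (`t ≥ 2`),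
with `C` from `exists_abs_reDigammaQuarter_le`. [folklore] -/
theorem abs_weight_crude {C : ℝ} (hC : ∀ τ : ℝ, |reDigammaQuarter τ| ≤ C + Real.log (1 + |τ|))
    (ht : 2 ≤ t) (τ : ℝ) :
    |reDigammaQuarter τ - Real.log (t / 2)| ≤ C + Real.log (1 + |τ|) + Real.log t := by
  have hl0 : 0 ≤ Real.log (t / 2) := Real.log_nonneg (by linarith)
  have hl1 : Real.log (t / 2) ≤ Real.log t := Real.log_le_log (by linarith) (by linarith)
  have := hC τ
  rw [abs_le] at this ⊢
  constructor <;> linarith [this.1, this.2]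

/-- **Region C₁ pointwise** (`0 ≤ τ ≤ t/2`):
`|Re ĝ| · |R − log(t/2)| ≤ (10 + 18L)(C + 1 + 2 log t)/t²`. [folklore] -/
theorem absF_le_C1 {C : ℝ} (hC : ∀ τ : ℝ, |reDigammaQuarter τ| ≤ C + Real.log (1 + |τ|))
    (hc0 : 0 ≤ c') (hc1 : c' ≤ 3 / 2) (ht : 8 ≤ t) (hL : 0 ≤ L) {τ : ℝ} (hτ0 : 0 ≤ τ) (hτ : τ ≤ t / 2) :
    |(weilMellin (test ((c' : ℂ) + t * I) L) (1 / 2 + τ * I)).re| * |reDigammaQuarter τ - Real.log (t / 2)| ≤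
      (10 + 18 * L) * (C + 1 + 2 * Real.log t) / t ^ 2 := by
  have h1 := abs_re_weilMellin_test_half_le_C1 hc0 hc1 ht hL hτ0 hτ
  have h2 := abs_weight_crude (t := t) hC (by linarith) τ
  have h3 : Real.log (1 + |τ|) ≤ 1 + Real.log t := by
    rw [abs_of_nonneg hτ0]
    have : Real.log (1 + τ) ≤ Real.log (2 * t) := Real.log_le_log (by linarith) (by linarith)
    rw [Real.log_mul (by norm_num) (by linarith)] at this
    have := Real.log_two_lt_d9; linarith
  have hlt : 0 ≤ Real.log t := Real.log_nonneg (by linarith)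
  calc |(weilMellin (test ((c' : ℂ) + t * I) L) (1 / 2 + τ * I)).re| * |reDigammaQuarter τ - Real.log (t / 2)|
      ≤ (10 + 18 * L) / t ^ 2 * (C + 1 + 2 * Real.log t) := by
        refine mul_le_mul h1 (by linarith) (abs_nonneg _) (by positivity)
    _ = (10 + 18 * L) * (C + 1 + 2 * Real.log t) / t ^ 2 := by ring

/-- **Near `τ = t` pointwise** (`|τ − t| ≤ 1`): `|Re ĝ| · |R − log(t/2)| ≤ 12 L²/t`. [folklore] -/
theorem absF_le_mid (hc0 : 0 ≤ c') (ht : 8 ≤ t) (hL : 0 ≤ L) {τ : ℝ} (hτ : |τ - t| ≤ 1) :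
    |(weilMellin (test ((c' : ℂ) + t * I) L) (1 / 2 + τ * I)).re| * |reDigammaQuarter τ - Real.log (t / 2)| ≤
      12 * L ^ 2 / t := by
  have ht0 : 0 < t := by linarith
  obtain ⟨hτ1, hτ2⟩ := abs_le.1 hτ
  have h1 : |(weilMellin (test ((c' : ℂ) + t * I) L) (1 / 2 + τ * I)).re| ≤ L ^ 2 :=
    (Complex.abs_re_le_norm _).trans (norm_weilMellin_test_half_le_sq (by simp [hc0]) hL τ)
  have h2 := abs_weight_regionA ht (τ := τ) (by linarith) (by linarith)
  have h3 : 10 / t + 2 * |τ - t| / t ≤ 12 / t := by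
    rw [← add_div, div_le_div_iff_of_pos_right ht0]; linarith
  calc |(weilMellin (test ((c' : ℂ) + t * I) L) (1 / 2 + τ * I)).re| * |reDigammaQuarter τ - Real.log (t / 2)|
      ≤ L ^ 2 * (12 / t) := mul_le_mul h1 (h2.trans h3) (abs_nonneg _) (by positivity)
    _ = 12 * L ^ 2 / t := by ring

/-- **Region A pointwise** (`t/2 ≤ τ ≤ 3t/2`, `|τ − t| ≥ 1`): `|Re ĝ| · |R − log(t/2)| ≤ 40 L/t`
(`L ≥ 1`, `t ≥ 8`). [folklore] -/
theorem absF_le_A (hc0 : 0 ≤ c') (ht : 8 ≤ t) (hL : 1 ≤ L) {τ : ℝ} (hτ1 : t / 2 ≤ τ) (hτ2 : τ ≤ 3 * t / 2)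
    (hω : 1 ≤ |τ - t|) :
    |(weilMellin (test ((c' : ℂ) + t * I) L) (1 / 2 + τ * I)).re| * |reDigammaQuarter τ - Real.log (t / 2)| ≤
      40 * L / t := by
  have ht0 : 0 < t := by linarith
  have hτt : τ ≠ t := by intro h; rw [h, sub_self, abs_zero] at hω; linarith
  set w : ℝ := |τ - t| with hw
  have hw2 : w ≤ t / 2 := by rw [hw, abs_le]; constructor <;> linarith
  have hw0 : 0 < w := by linarith
  have h1 : |(weilMellin (test ((c' : ℂ) + t * I) L) (1 / 2 + τ * I)).re| ≤
      (2 / w ^ 2 + L / w) + (2 / t ^ 2 + L / t) := by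
    refine (Complex.abs_re_le_norm _).trans ?_
    have := norm_weilMellin_test_half_le_A (L := L) hc0 ht0 (by linarith) (τ := τ) (by linarith) hτt
    rwa [← sq_abs (τ - t)] at this
  have h2 := abs_weight_regionA ht hτ1 hτ2
  rw [← hw] at h2
  -- multiply out: `t · LHS ≤ (2/w² + L/w + 2/t² + L/t)(10 + 2w) ≤ 40 L`
  have hprod : ((2 / w ^ 2 + L / w) + (2 / t ^ 2 + L / t)) * (10 / t + 2 * w / t) ≤ 40 * L / t := by
    have e : ((2 / w ^ 2 + L / w) + (2 / t ^ 2 + L / t)) * (10 / t + 2 * w / t) =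
        (((2 / w ^ 2 + L / w) + (2 / t ^ 2 + L / t)) * (10 + 2 * w)) / t := by ring
    rw [e, div_le_div_iff_of_pos_right ht0]
    -- six term bounds
    have b1 : 2 / w ^ 2 * 10 ≤ 20 := by
      rw [div_mul_eq_mul_div, div_le_iff₀ (by positivity)]; nlinarith
    have b2 : 2 / w ^ 2 * (2 * w) ≤ 4 := by
      rw [div_mul_eq_mul_div, div_le_iff₀ (by positivity)]; nlinarith
    have b3 : L / w * 10 ≤ 10 * L := by
      rw [div_mul_eq_mul_div, div_le_iff₀ hw0]; nlinarith
    have b4 : L / w * (2 * w) = 2 * L := by field_simp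
    have b5 : 2 / t ^ 2 * (10 + 2 * w) ≤ 1 := by
      rw [div_mul_eq_mul_div, div_le_iff₀ (by positivity)]; nlinarith
    have b6 : L / t * (10 + 2 * w) ≤ 3 * L := by
      rw [div_mul_eq_mul_div, div_le_iff₀ ht0]; nlinarith
    nlinarith [b1, b2, b3, b4, b5, b6]
  calc |(weilMellin (test ((c' : ℂ) + t * I) L) (1 / 2 + τ * I)).re| * |reDigammaQuarter τ - Real.log (t / 2)|
      ≤ ((2 / w ^ 2 + L / w) + (2 / t ^ 2 + L / t)) * (10 / t + 2 * w / t) :=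
        mul_le_mul h1 h2 (abs_nonneg _) (by positivity)
    _ ≤ 40 * L / t := hprod

/-- `log(1 + τ) ≤ 2 √τ` for `τ ≥ 1`. [folklore] -/
theorem log_one_add_le_two_sqrt {τ : ℝ} (hτ : 1 ≤ τ) : Real.log (1 + τ) ≤ 2 * Real.sqrt τ := by
  have h1 : Real.log (1 + τ) ≤ Real.log (2 * τ) := Real.log_le_log (by linarith) (by linarith)
  rw [Real.log_mul (by norm_num) (by linarith)] at h1
  have h2 : Real.log τ = 2 * Real.log (Real.sqrt τ) := by
    rw [Real.log_sqrt (by linarith)]; ring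
  have h3 : Real.log (Real.sqrt τ) ≤ Real.sqrt τ - 1 := Real.log_le_sub_one_of_pos (Real.sqrt_pos.2 (by linarith))
  have h4 : 1 ≤ Real.sqrt τ := by rw [Real.le_sqrt (by norm_num) (by linarith)]; linarith
  have := Real.log_two_lt_d9
  linarith

/-- **Region C₂ pointwise** (`τ ≥ 3t/2`):
`|Re ĝ| · |R − log(t/2)| ≤ (20 + 18L)((C + log t) τ^{−2} + 2 τ^{−3/2})`. [folklore] -/
theorem absF_le_C2 {C : ℝ} (hC0 : 0 ≤ C) (hC : ∀ τ : ℝ, |reDigammaQuarter τ| ≤ C + Real.log (1 + |τ|))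
    (hc0 : 0 ≤ c') (hc1 : c' ≤ 3 / 2) (ht : 8 ≤ t) (hL : 0 ≤ L) {τ : ℝ} (hτ : 3 * t / 2 ≤ τ) :
    |(weilMellin (test ((c' : ℂ) + t * I) L) (1 / 2 + τ * I)).re| * |reDigammaQuarter τ - Real.log (t / 2)| ≤
      (20 + 18 * L) * ((C + Real.log t) * τ ^ (-(2 : ℝ)) + 2 * τ ^ (-(3 / 2 : ℝ))) := by
  have hτ0 : 0 < τ := by linarith
  have hτ1 : 1 ≤ τ := by linarith
  have h1 := abs_re_weilMellin_test_half_le_C2 hc0 hc1 ht hL hτ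
  have h2 := abs_weight_crude (t := t) hC (by linarith) τ
  rw [abs_of_pos hτ0] at h2
  have h3 := log_one_add_le_two_sqrt hτ1
  have hlt : 0 ≤ Real.log t := Real.log_nonneg (by linarith)
  have hw : |reDigammaQuarter τ - Real.log (t / 2)| ≤ (C + Real.log t) + 2 * Real.sqrt τ := by linarith
  have e2 : τ ^ (-(2 : ℝ)) = 1 / τ ^ 2 := by
    rw [Real.rpow_neg hτ0.le, one_div]; norm_cast
  have e3 : Real.sqrt τ / τ ^ 2 = τ ^ (-(3 / 2 : ℝ)) := by
    rw [Real.sqrt_eq_rpow, div_eq_iff (by positivity), ← Real.rpow_natCast,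
      ← Real.rpow_add hτ0]
    norm_num
  calc |(weilMellin (test ((c' : ℂ) + t * I) L) (1 / 2 + τ * I)).re| * |reDigammaQuarter τ - Real.log (t / 2)|
      ≤ (20 + 18 * L) / τ ^ 2 * ((C + Real.log t) + 2 * Real.sqrt τ) :=
        mul_le_mul h1 hw (abs_nonneg _) (by positivity)
    _ = (20 + 18 * L) * ((C + Real.log t) * (1 / τ ^ 2) + 2 * (Real.sqrt τ / τ ^ 2)) := by
        field_simp
    _ = (20 + 18 * L) * ((C + Real.log t) * τ ^ (-(2 : ℝ)) + 2 * τ ^ (-(3 / 2 : ℝ))) := by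
        rw [e2, e3]

end Regions

/-! ## The error integral `∫ |Re ĝ(½+iτ)| · |R(τ) − log(t/2)| dτ = O(L)` -/

/-- **The error integral is `O(L)`**: there is an absolute `K` with
`∫ |Re ĝ(½+iτ)| |Re ψ(¼+iτ/2) − log(t/2)| dτ ≤ K L` for `c = c' + it`, `0 ≤ c' ≤ 3/2`, `t ≥ 8`,
`1 ≤ L ≤ t`. [cite: BalazardDeRoton2008, Prop. 5 (proof)] -/
theorem integral_absF_le : ∃ K : ℝ, 0 ≤ K ∧ ∀ c' t L : ℝ, 0 ≤ c' → c' ≤ 3 / 2 → 8 ≤ t → 1 ≤ L → L ≤ t →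
    ∫ τ : ℝ, |(weilMellin (test ((c' : ℂ) + t * I) L) (1 / 2 + τ * I)).re| *
        |reDigammaQuarter τ - Real.log (t / 2)| ≤ K * L := by
  obtain ⟨C, hC0, hC⟩ := exists_abs_reDigammaQuarter_le
  refine ⟨2 * (66 * (C + 2) + 64), by positivity, fun c' t L hc0 hc1 ht hL hLt ↦ ?_⟩
  have ht0 : 0 < t := by linarith
  have hL0 : 0 ≤ L := by linarith
  set c : ℂ := (c' : ℂ) + t * I with hc
  have hcre : 0 ≤ c.re := by simp [hc, hc0]
  set G : ℝ → ℝ := fun τ ↦ |(weilMellin (test c L) (1 / 2 + τ * I)).re| *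
    |reDigammaQuarter τ - Real.log (t / 2)| with hG
  have hGnn : ∀ τ, 0 ≤ G τ := fun τ ↦ by positivity
  have hGeven : ∀ τ, G (-τ) = G τ := by
    intro τ
    simp only [hG]
    rw [reDigammaQuarter_even, ← weilMellin_test_half_neg c hL0 τ]
  -- continuity and integrability of `G`
  have hgc : Continuous fun τ : ℝ ↦ weilMellin (test c L) (1 / 2 + τ * I) :=
    (continuous_weilMellin (continuous_test c L) (hasCompactSupport_test c L)).comp (by fun_prop)
  have hGint : Integrable G := by
    -- `G = |Re(ĝ R) − log(t/2) Re ĝ|`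
    have h1 : Integrable fun τ : ℝ ↦ (weilMellin (test c L) (1 / 2 + τ * I) *
        ((Complex.digamma (1 / 4 + τ / 2 * I)).re : ℂ)).re :=
      Complex.reCLM.integrable_comp (integrable_weilMellin_test_mul_reDigamma hcre hL0)
    have h2 : Integrable fun τ : ℝ ↦ (weilMellin (test c L) (1 / 2 + τ * I)).re :=
      Complex.reCLM.integrable_comp (integrable_weilMellin_test_half hcre hL0)
    have h3 := (h1.sub (h2.const_mul (Real.log (t / 2)))).abs
    refine h3.congr (Eventually.of_forall fun τ ↦ ?_)
    simp only [Pi.sub_apply, hG]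
    rw [← abs_mul]
    congr 1
    simp only [reDigammaQuarter, Complex.mul_re, Complex.ofReal_re, Complex.ofReal_im, mul_zero, sub_zero]
    ring
  -- reduce to `τ > 0`
  have hhalf : ∫ τ, G τ = 2 * ∫ τ in Ioi (0 : ℝ), G τ := by
    rw [← integral_comp_abs]
    refine integral_congr_ae (Eventually.of_forall fun τ ↦ ?_)
    show G τ = G |τ|
    rcases abs_choice τ with h | h
    · rw [h]
    · rw [h, hGeven]
  -- splitting tool
  have hsplit : ∀ a b : ℝ, a ≤ b → ∫ τ in Ioi a, G τ = (∫ τ in Ioc a b, G τ) + ∫ τ in Ioi b, G τ := by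
    intro a b hab
    rw [← Ioc_union_Ioi_eq_Ioi hab, setIntegral_union Ioc_disjoint_Ioi_same measurableSet_Ioi
      hGint.integrableOn hGint.integrableOn]
  -- bound on a bounded piece by a constant
  have hpiece : ∀ a b M : ℝ, a ≤ b → (∀ τ ∈ Ioc a b, G τ ≤ M) → ∫ τ in Ioc a b, G τ ≤ M * (b - a) := by
    intro a b M hab hM
    calc ∫ τ in Ioc a b, G τ ≤ ∫ _ in Ioc a b, M :=
          setIntegral_mono_on hGint.integrableOn (integrableOn_const (by simp [Real.volume_Ioc]))
            measurableSet_Ioc hM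
      _ = M * (b - a) := by
          rw [setIntegral_const, Real.volume_real_Ioc, max_eq_left (by linarith), smul_eq_mul, mul_comm]
  -- the five pieces
  have hP1 : ∫ τ in Ioc 0 (t / 2), G τ ≤ 28 * (C + 2) * L := by
    have hM : ∀ τ ∈ Ioc 0 (t / 2), G τ ≤ (10 + 18 * L) * (C + 1 + 2 * Real.log t) / t ^ 2 :=
      fun τ hτ ↦ absF_le_C1 hC hc0 hc1 ht hL0 hτ.1.le hτ.2
    refine (hpiece 0 (t / 2) _ (by linarith) hM).trans ?_
    have hlog : Real.log t ≤ t := (Real.log_le_sub_one_of_pos ht0).trans (by linarith)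
    have hlog0 : 0 ≤ Real.log t := Real.log_nonneg (by linarith)
    rw [sub_zero, div_mul_eq_mul_div, div_le_iff₀ (by positivity)]
    -- `(10+18L)(C+1+2 log t) t/2 ≤ 28(C+2)L t²`
    have h1 : 10 + 18 * L ≤ 28 * L := by linarith
    have hlog1 : Real.log t ≤ t - 1 := Real.log_le_sub_one_of_pos ht0
    have hCt : C ≤ C * t := le_mul_of_one_le_right hC0 (by linarith)
    have h2 : C + 1 + 2 * Real.log t ≤ (C + 2) * t := by nlinarith
    have h3 := mul_le_mul h1 h2 (by positivity) (by positivity)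
    have h4 := mul_le_mul_of_nonneg_right h3 (by positivity : 0 ≤ t / 2)
    have h5 : 28 * L * ((C + 2) * t) * (t / 2) ≤ 28 * (C + 2) * L * t ^ 2 := by
      nlinarith [(by positivity : 0 ≤ L * (C + 2) * t ^ 2)]
    linarith
  have hP2 : ∫ τ in Ioc (t / 2) (t - 1), G τ ≤ 20 * L := by
    have hM : ∀ τ ∈ Ioc (t / 2) (t - 1), G τ ≤ 40 * L / t := fun τ hτ ↦
      absF_le_A hc0 ht hL hτ.1.le (by linarith [hτ.2]) (by rw [abs_of_nonpos (by linarith [hτ.2])]; linarith [hτ.2])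
    refine (hpiece _ _ _ (by linarith) hM).trans ?_
    rw [div_mul_eq_mul_div, div_le_iff₀ ht0]; nlinarith
  have hP3 : ∫ τ in Ioc (t - 1) (t + 1), G τ ≤ 24 * L := by
    have hM : ∀ τ ∈ Ioc (t - 1) (t + 1), G τ ≤ 12 * L ^ 2 / t := fun τ hτ ↦
      absF_le_mid hc0 ht hL0 (abs_le.2 ⟨by linarith [hτ.1], by linarith [hτ.2]⟩)
    refine (hpiece _ _ _ (by linarith) hM).trans ?_
    rw [div_mul_eq_mul_div, div_le_iff₀ ht0]
    nlinarith [mul_le_mul_of_nonneg_left hLt (by positivity : 0 ≤ 24 * L)]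
  have hP4 : ∫ τ in Ioc (t + 1) (3 * t / 2), G τ ≤ 20 * L := by
    have hM : ∀ τ ∈ Ioc (t + 1) (3 * t / 2), G τ ≤ 40 * L / t := fun τ hτ ↦
      absF_le_A hc0 ht hL (by linarith [hτ.1]) hτ.2 (by rw [abs_of_nonneg (by linarith [hτ.1])]; linarith [hτ.1])
    refine (hpiece _ _ _ (by linarith) hM).trans ?_
    rw [div_mul_eq_mul_div, div_le_iff₀ ht0]; nlinarith
  have hP5 : ∫ τ in Ioi (3 * t / 2), G τ ≤ 38 * (C + 2) * L := by
    set a : ℝ := 3 * t / 2 with ha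
    have ha0 : 0 < a := by positivity
    have ha12 : 12 ≤ a := by rw [ha]; linarith
    set M : ℝ → ℝ := fun τ ↦ (20 + 18 * L) * ((C + Real.log t) * τ ^ (-(2 : ℝ)) + 2 * τ ^ (-(3 / 2 : ℝ)))
      with hMdef
    have hr2 := integrableOn_Ioi_rpow_of_lt (by norm_num : (-(2 : ℝ)) < -1) ha0
    have hr3 := integrableOn_Ioi_rpow_of_lt (by norm_num : (-(3 / 2 : ℝ)) < -1) ha0
    have hMint : IntegrableOn M (Ioi a) := ((hr2.const_mul _).add (hr3.const_mul _)).const_mul _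
    have hle : ∀ τ ∈ Ioi a, G τ ≤ M τ := fun τ hτ ↦ absF_le_C2 hC0 hC hc0 hc1 ht hL0 (le_of_lt hτ)
    refine (setIntegral_mono_on hGint.integrableOn hMint measurableSet_Ioi hle).trans ?_
    have hI2 := integral_Ioi_rpow_of_lt (by norm_num : (-(2 : ℝ)) < -1) ha0
    have hI3 := integral_Ioi_rpow_of_lt (by norm_num : (-(3 / 2 : ℝ)) < -1) ha0
    have hMI : ∫ τ in Ioi a, M τ =
        (20 + 18 * L) * ((C + Real.log t) * (-a ^ (-(2 : ℝ) + 1) / (-(2 : ℝ) + 1)) +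
          2 * (-a ^ (-(3 / 2 : ℝ) + 1) / (-(3 / 2 : ℝ) + 1))) := by
      simp only [hMdef]
      rw [MeasureTheory.integral_const_mul, integral_add (hr2.const_mul _) (hr3.const_mul _),
        MeasureTheory.integral_const_mul, MeasureTheory.integral_const_mul, hI2, hI3]
    rw [hMI]
    -- simplify the powers: `a^{-1} ≤ 1/12`, `a^{-1/2} ≤ 1/3`
    have e1 : -a ^ (-(2 : ℝ) + 1) / (-(2 : ℝ) + 1) = a⁻¹ := by
      norm_num [Real.rpow_neg_one]
    have e2 : -a ^ (-(3 / 2 : ℝ) + 1) / (-(3 / 2 : ℝ) + 1) = 2 * (Real.sqrt a)⁻¹ := by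
      have : (-(3 / 2 : ℝ) + 1) = -(1 / 2) := by norm_num
      rw [this, Real.rpow_neg ha0.le, ← Real.sqrt_eq_rpow]
      ring
    rw [e1, e2]
    have hainv : a⁻¹ ≤ 1 / 12 := by rw [inv_eq_one_div]; exact one_div_le_one_div_of_le (by norm_num) ha12
    have hsqrt : (Real.sqrt a)⁻¹ ≤ 1 / 3 := by
      rw [inv_eq_one_div]
      refine one_div_le_one_div_of_le (by norm_num) ?_
      rw [Real.le_sqrt (by norm_num) ha0.le]; linarith
    have hlog : Real.log t ≤ t := (Real.log_le_sub_one_of_pos ht0).trans (by linarith)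
    have hlog0 : 0 ≤ Real.log t := Real.log_nonneg (by linarith)
    have hat : (C + Real.log t) * a⁻¹ ≤ C / 12 + 2 / 3 := by
      have h1 : (C + Real.log t) * a⁻¹ ≤ (C + t) * a⁻¹ := by gcongr
      have h2 : (C + t) * a⁻¹ = C * a⁻¹ + t / a := by ring
      have h3 : t / a = 2 / 3 := by rw [ha]; field_simp
      have h4 : C * a⁻¹ ≤ C * (1 / 12) := by gcongr
      linarith
    have h5 : 2 * (2 * (Real.sqrt a)⁻¹) ≤ 4 / 3 := by linarith
    have h6 : 0 ≤ 20 + 18 * L := by positivity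
    calc (20 + 18 * L) * ((C + Real.log t) * a⁻¹ + 2 * (2 * (Real.sqrt a)⁻¹))
        ≤ (20 + 18 * L) * ((C / 12 + 2 / 3) + 4 / 3) := by nlinarith [hat, h5, h6]
      _ ≤ 38 * (C + 2) * L := by nlinarith
  -- assemble
  rw [hhalf, hsplit 0 (t / 2) (by linarith), hsplit (t / 2) (t - 1) (by linarith),
    hsplit (t - 1) (t + 1) (by linarith), hsplit (t + 1) (3 * t / 2) (by linarith)]
  nlinarith [hP1, hP2, hP3, hP4, hP5]

/-! ## The evaluation of the archimedean term -/

/-- **`Re W_∞(g_z) = L log t + O(L)`**: there is an absolute `K` such that for `c = c' + it`,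
`0 ≤ c' ≤ 3/2`, `t ≥ 8`, `1 ≤ L ≤ t`,
`|Re (weilArchTerm g) − L log t| ≤ K L` for `g = SoundTest.test c L`. This is the archimedean input
replacing `−(ζ'/ζ)(z) log x − (ζ'/ζ)'(z)` of BR (t55) in the Weil-formula proof of BR Prop. 5. [cite: BalazardDeRoton2008, Prop. 5 (proof)] -/
theorem re_weilArchTerm_test : ∃ K : ℝ, 0 ≤ K ∧ ∀ c' t L : ℝ, 0 ≤ c' → c' ≤ 3 / 2 → 8 ≤ t → 1 ≤ L → L ≤ t →
    |(weilArchTerm (test ((c' : ℂ) + t * I) L)).re - L * Real.log t| ≤ K * L := by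
  obtain ⟨K, hK0, hK⟩ := integral_absF_le
  refine ⟨K + 3, by positivity, fun c' t L hc0 hc1 ht hL hLt ↦ ?_⟩
  have ht0 : 0 < t := by linarith
  have hL0 : 0 ≤ L := by linarith
  set c : ℂ := (c' : ℂ) + t * I with hc
  have hcre : 0 ≤ c.re := by simp [hc, hc0]
  set ℓ : ℝ := Real.log (t / 2) with hℓ
  have hA := integrable_weilMellin_test_mul_reDigamma hcre hL0
  have hgi := integrable_weilMellin_test_half hcre hL0
  -- `Re (arch integral) = ∫ Re ĝ · R`
  have hre_int : (weilArchIntegral (test c L)).re =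
      ∫ τ : ℝ, (weilMellin (test c L) (1 / 2 + τ * I)).re * reDigammaQuarter τ := by
    unfold weilArchIntegral
    rw [← Complex.reCLM_apply, ← ContinuousLinearMap.integral_comp_comm _ hA]
    refine integral_congr_ae (Eventually.of_forall fun τ ↦ ?_)
    simp [reDigammaQuarter, Complex.mul_re]
  -- `∫ Re ĝ = 2πL`
  have hmass : ∫ τ : ℝ, (weilMellin (test c L) (1 / 2 + τ * I)).re = 2 * π * L := by
    have h := integral_weilMellin_test_half hcre hL0
    have h2 : (∫ τ : ℝ, (weilMellin (test c L) (1 / 2 + τ * I)).re) = (∫ τ : ℝ, weilMellin (test c L) (1 / 2 + τ * I)).re := by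
      rw [← Complex.reCLM_apply, ← ContinuousLinearMap.integral_comp_comm _ hgi]; rfl
    rw [h2, h]
    simp
  -- split `R = (R − ℓ) + ℓ`
  have hFint : Integrable fun τ : ℝ ↦ (weilMellin (test c L) (1 / 2 + τ * I)).re * (reDigammaQuarter τ - ℓ) := by
    have h1 : Integrable fun τ : ℝ ↦ (weilMellin (test c L) (1 / 2 + τ * I)).re * reDigammaQuarter τ := by
      have := (Complex.reCLM.integrable_comp hA)
      refine this.congr (Eventually.of_forall fun τ ↦ ?_)
      simp [reDigammaQuarter, Complex.mul_re]
    have h2 : Integrable fun τ : ℝ ↦ (weilMellin (test c L) (1 / 2 + τ * I)).re := Complex.reCLM.integrable_comp hgi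
    exact (h1.sub (h2.mul_const ℓ)).congr (Eventually.of_forall fun τ ↦ by simp only [Pi.sub_apply]; ring)
  have hsplit : (∫ τ : ℝ, (weilMellin (test c L) (1 / 2 + τ * I)).re * reDigammaQuarter τ) =
      (∫ τ : ℝ, (weilMellin (test c L) (1 / 2 + τ * I)).re * (reDigammaQuarter τ - ℓ)) + ℓ * (2 * π * L) := by
    rw [← hmass, ← MeasureTheory.integral_const_mul, ← integral_add hFint]
    · refine integral_congr_ae (Eventually.of_forall fun τ ↦ ?_); ring
    · exact (Complex.reCLM.integrable_comp hgi).const_mul ℓ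
  -- the error integral
  set E : ℝ := ∫ τ : ℝ, (weilMellin (test c L) (1 / 2 + τ * I)).re * (reDigammaQuarter τ - ℓ) with hE
  have hEabs : |E| ≤ K * L := by
    refine (MeasureTheory.abs_integral_le_integral_abs).trans ?_
    simp only [abs_mul]
    exact hK c' t L hc0 hc1 ht hL hLt
  -- `Re (weilArchTerm (test c L)) = (1/2π)(E + ℓ 2πL) − L log π`
  have hg0 : test c L 0 = (L : ℂ) := test_zero c hL0
  have hre : (weilArchTerm (test c L)).re = (1 / (2 * π)) * (E + ℓ * (2 * π * L)) - L * Real.log π := by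
    unfold weilArchTerm
    rw [Complex.sub_re, hg0]
    have e1 : ((1 / (2 * π) : ℂ) * weilArchIntegral (test c L)).re = 1 / (2 * π) * (weilArchIntegral (test c L)).re := by
      have : (1 / (2 * π) : ℂ) = ((1 / (2 * π) : ℝ) : ℂ) := by push_cast; ring
      rw [this, Complex.re_ofReal_mul]
    have e2 : ((L : ℂ) * (Real.log π : ℂ)).re = L * Real.log π := by
      rw [← Complex.ofReal_mul, Complex.ofReal_re]
    rw [e1, e2, hre_int, hsplit]
  rw [hre]
  have hπ : (0 : ℝ) < π := Real.pi_pos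
  have key : 1 / (2 * π) * (E + ℓ * (2 * π * L)) - L * Real.log π - L * Real.log t =
      E / (2 * π) - L * (Real.log 2 + Real.log π) := by
    have : ℓ = Real.log t - Real.log 2 := by rw [hℓ, Real.log_div (by linarith) (by norm_num)]
    rw [this]; field_simp; ring
  rw [key]
  have hl2 : Real.log 2 ≤ 1 := by have := Real.log_two_lt_d9; linarith
  have hlπ : Real.log π ≤ 2 := by
    have h4 : Real.log π ≤ Real.log 4 := Real.log_le_log hπ (by linarith [Real.pi_lt_four])
    have : Real.log 4 = 2 * Real.log 2 := by
      rw [show (4 : ℝ) = 2 ^ 2 by norm_num, Real.log_pow]; push_cast; ring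
    linarith
  have hlπ0 : 0 ≤ Real.log π := Real.log_nonneg (by linarith [Real.pi_gt_three])
  have hE2 : |E / (2 * π)| ≤ K * L := by
    rw [abs_div, abs_of_pos (by positivity : (0 : ℝ) < 2 * π), div_le_iff₀ (by positivity)]
    have : K * L ≤ K * L * (2 * π) := le_mul_of_one_le_right (by positivity) (by linarith [Real.pi_gt_three])
    exact hEabs.trans this
  have hl20 : 0 ≤ Real.log 2 := Real.log_nonneg (by norm_num)
  have := abs_le.1 hE2
  rw [abs_le]; constructor <;> nlinarith [this.1, this.2]

end SoundTest

end Literature.NumberTheory.LFunctions
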